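import Summits.QuantumFields.BalabanUV.Beta.D1BFx.LamCoeffAffineNull
import Summits.QuantumFields.BalabanUV.Beta.D1BFx.LamFactor

/-!
# `BalabanUV.Beta.D1BFx.LamCoeffMoments` — road «BF-x» for binder row D1, slot (K), census group **G_Λ** AT THE ROAD'S OWN MULTIPLIER RESPONSE:
# identities (I) (`LamCoeffAffineNull`, p250824) and (II) (`LamFactor`, p251485) COMPOSED — for every block-translation invariant summable left kernel
# `A` (`Decays A C δ`, `shiftK (−N•t) A = A`; e.g. Bałaban's `KInv`), every fine direction `κ′` and every block-covariant, exponentially localised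
# response family `Nr`, the word `W(u,u′) = Σ_μ Σ_y lamCoeffOf A N μ y κ′ u · Nr μ y u′` has block-averaged moments
#   `M₀ = 0`   and   `M₂^{αβ} = N^{−(d+1)} Σ_μ q^Λ_{αβ}(μ) · N̄(μ)`,   hence `M₂ = 0` whenever the zero-momentum responses `N̄(μ) = Σ_{u′} Nr μ 0 u′` vanish
# — the shape of the END row `hLam`: the G_Λ group is `(0;0)` MODULO the linear-gauge letter `Σ_X N̄_X + seagull = 0` (FINDING F-g9-1), nothing else

HONEST DEPENDENCY (cell records, verbatim): «continuum YM on T⁴ ⇐ BetaPertH ∧ nine spine estimates (0/9 proved); BetaPertH ⇐ (D1) ∧ (D4) ∧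
CAP+tail; G-an2-4 gates asym, D1 and NE2/3/4.»  HONEST FRAMING (cell contract, verbatim): «discharging `BetaPertH` makes Bałaban's UV stability
UNCONDITIONAL — a real constructive-QFT result; it is NOT the continuum limit and NOT the Clay problem.»  THIS MODULE DISCHARGES NOTHING of (K),
of D1 or of the wall: [folklore] composition BY NAME of `LamCoeffAffineNull.tsum_affine_mul_lamCoeffOf` (nulls), `BalabanStepJets.lamCoeffOf_translate`
(covariance), `BalabanStepJets.abs_lamCoeffOf_le` (decay) into `LamFactor.blockAvg_M0_eq_zero_of_decay` ∕ `blockAvg_M2_eq_of_decay` (leaf-04-g8).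
No definition, no `def … : Prop`, nothing cited, no wall binder instantiated, 0 sorry.  The response family `Nr` and its zero-momentum letter stay
ABSTRACT ∕ DISPLAYED.  NOT D1, NOT BetaPertH, NOT continuum, NOT Clay.

ABSOLUTE RULE (cell charter, verbatim): «No internally-minted statement may enter as a cited fact. Every hypothesis is either kernel-proved in this
package or a verbatim quotation of a PUBLISHED theorem with page reference. The manuscript(s) under audit are NOT citable for their own disputed
steps — they are the thing under adjudication; programme-internal (2001/route/tribunal) claims are never citable.»

CONTENT ([folklore]): §1 the three instance letters of `Λ := lamCoeffOf A N · · κ′` (`lamCoeff_cov`, `lamCoeff_decay`, `lamCoeff_null₀`, `lamCoeff_null₁`);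
§2 **`blockAvg_M0_lamCoeffOf_eq_zero`**, **`blockAvg_M2_lamCoeffOf_eq`**, **`blockAvg_M2_lamCoeffOf_eq_zero_of_zeroMomentum`**.
Unit `b2b-balaban-beta-d1-p2` (road owner, gen 9); `K-CLOSURE-PLAN-R1L.md` §4 (Λ) ∕ §6.
-/

noncomputable section

open Finset Filter Topology
open scoped BigOperators
open Literature.MathematicalPhysics.QuantumFieldTheory.Balaban1983to89
open Literature.MathematicalPhysics.QuantumFieldTheory.Balaban1983to89.Beta
open B12Sec2to5 (l1 l1_nonneg)
open ExpKernelCalculus (Decays MKer shiftK)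
open OneStepResolventKernel (Fib)
open AffineAveraging (Site box toSite)
open BalabanStepJets (lamCoeffOf lamCoeffOf_translate abs_lamCoeffOf_le)
open Summit.QuantumFields.BalabanUV.Beta.D1BFx.LamCoeffAffineNull (tsum_affine_mul_lamCoeffOf)
open Summit.QuantumFields.BalabanUV.Beta.D1BFx.LamFactor (blockAvg_M0_eq_zero_of_decay blockAvg_M2_eq_of_decay)

namespace Summit.QuantumFields.BalabanUV.Beta.D1BFx.LamCoeffMoments

variable {d : ℕ} {A : MKer (d + 1) (Fib d)} {C δ : ℝ} {N : ℕ}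

/-! ## §1 The instance letters of `Λ := lamCoeffOf A N · · κ′` -/

/-- [folklore] COVARIANCE letter of the instance: block-translation invariance of `A` gives `Λ μ (y+t) (u + N•t) = Λ μ y u`. -/
theorem lamCoeff_cov (hAcov : ∀ t : Fin (d + 1) → ℤ, shiftK (-((N : ℤ) • t)) A = A) (κ' : Fin (d + 1)) :
    ∀ (μ : Fin (d + 1)) (y t u : Site (d + 1)),
      lamCoeffOf A N μ (y + t) κ' (u + (N : ℤ) • t) = lamCoeffOf A N μ y κ' u :=
  fun μ y t u => lamCoeffOf_translate hAcov μ y κ' u t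

/-- [folklore] DECAY letter of the instance (`abs_lamCoeffOf_le` with its constant named). -/
theorem lamCoeff_decay (hA : Decays A C δ) (hC : 0 ≤ C) (hδ : 0 < δ) (κ' : Fin (d + 1)) :
    ∀ (μ : Fin (d + 1)) (y u : Site (d + 1)), |lamCoeffOf A N μ y κ' u| ≤
      ((3 : ℝ) ^ (d + 1) * ((d + 1 : ℕ) : ℝ) * (16 * ((d + 1 : ℕ) : ℝ)) * C * Real.exp (((d + 1 : ℕ) : ℝ) * δ)) *
        Real.exp (-δ * l1 ((N : ℤ) • y - u)) :=
  fun μ y u => abs_lamCoeffOf_le hA hC hδ.le μ y κ' u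

/-- [folklore] MONOPOLE NULL of the instance at the base block: `Σ'_u Λ μ 0 u = 0` (p250824 with `m = 0`, `c = 1`). -/
theorem lamCoeff_null₀ (hA : Decays A C δ) (hC : 0 ≤ C) (hδ : 0 < δ) (κ' : Fin (d + 1)) :
    ∀ μ : Fin (d + 1), ∑' u : Site (d + 1), lamCoeffOf A N μ 0 κ' u = 0 := by
  intro μ
  have h := tsum_affine_mul_lamCoeffOf hA hC hδ (fun _ => (0 : ℝ)) 1 N μ 0 κ'
  simpa only [zero_mul, Finset.sum_const_zero, zero_add, one_mul] using h

/-- [folklore] DIPOLE NULL of the instance at the base block: `Σ'_u u_γ · Λ μ 0 u = 0` (p250824 with `m = e_γ`, `c = 0`). -/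
theorem lamCoeff_null₁ (hA : Decays A C δ) (hC : 0 ≤ C) (hδ : 0 < δ) (κ' : Fin (d + 1)) :
    ∀ μ γ : Fin (d + 1), ∑' u : Site (d + 1), ((u γ : ℤ) : ℝ) * lamCoeffOf A N μ 0 κ' u = 0 := by
  intro μ γ
  have h := tsum_affine_mul_lamCoeffOf hA hC hδ (fun β => if β = γ then (1 : ℝ) else 0) 0 N μ 0 κ'
  simpa only [ite_mul, one_mul, zero_mul, Finset.sum_ite_eq', Finset.mem_univ, if_true, add_zero] using h

/-! ## §2 The block-averaged moments of the road's `Λ′⊗X` words -/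

/-- [folklore] **G_Λ, MONOPOLE: the block-averaged zeroth moment of every `Λ′⊗X` word of the road VANISHES** — for every block-translation
invariant summable left kernel `A`, fine direction `κ′`, and block-covariant exponentially localised response family `Nr`. -/
theorem blockAvg_M0_lamCoeffOf_eq_zero [NeZero N] (hA : Decays A C δ) (hC : 0 ≤ C) (hδ : 0 < δ)
    (hAcov : ∀ t : Fin (d + 1) → ℤ, shiftK (-((N : ℤ) • t)) A = A) (κ' : Fin (d + 1))
    (Nr : Fin (d + 1) → Site (d + 1) → Site (d + 1) → ℝ) {C' δ' : ℝ} (hδ' : 0 < δ')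
    (hcovN : ∀ μ y t u', Nr μ (y + t) (u' + (N : ℤ) • t) = Nr μ y u')
    (hNr : ∀ μ y u, |Nr μ y u| ≤ C' * Real.exp (-δ' * l1 ((N : ℤ) • y - u))) :
    ((N : ℝ) ^ (d + 1))⁻¹ * ∑ b ∈ box (d + 1) N, ∑' u', (∑ μ, ∑' y, lamCoeffOf A N μ y κ' (toSite b) * Nr μ y u') = 0 :=
  blockAvg_M0_eq_zero_of_decay N (Λ := fun μ y u => lamCoeffOf A N μ y κ' u) (Nr := Nr) (lamCoeff_cov hAcov κ') hcovN hδ hδ'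
    (lamCoeff_decay hA hC hδ κ') hNr (lamCoeff_null₀ hA hC hδ κ')

/-- [folklore] **G_Λ, QUADRUPOLE: the block-averaged second moment of every `Λ′⊗X` word of the road FACTORISES** through the zero-momentum
responses `N̄(μ) = Σ'_{u′} Nr μ 0 u′`: `M₂^{αβ} = N^{−(d+1)} Σ_μ q^Λ_{αβ}(μ)·N̄(μ)`, `q^Λ_{αβ}(μ) = Σ'_w w_α w_β · lamCoeffOf A N μ 0 κ′ w`. -/
theorem blockAvg_M2_lamCoeffOf_eq [NeZero N] (hA : Decays A C δ) (hC : 0 ≤ C) (hδ : 0 < δ)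
    (hAcov : ∀ t : Fin (d + 1) → ℤ, shiftK (-((N : ℤ) • t)) A = A) (κ' α β : Fin (d + 1))
    (Nr : Fin (d + 1) → Site (d + 1) → Site (d + 1) → ℝ) {C' δ' : ℝ} (hδ' : 0 < δ')
    (hcovN : ∀ μ y t u', Nr μ (y + t) (u' + (N : ℤ) • t) = Nr μ y u')
    (hNr : ∀ μ y u, |Nr μ y u| ≤ C' * Real.exp (-δ' * l1 ((N : ℤ) • y - u))) :
    ((N : ℝ) ^ (d + 1))⁻¹ * ∑ b ∈ box (d + 1) N, ∑' u', ((((u' - toSite b) α : ℤ) : ℝ) * (((u' - toSite b) β : ℤ) : ℝ))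
        * (∑ μ, ∑' y, lamCoeffOf A N μ y κ' (toSite b) * Nr μ y u')
      = ((N : ℝ) ^ (d + 1))⁻¹ * ∑ μ, (∑' w : Site (d + 1), ((w α : ℤ) : ℝ) * ((w β : ℤ) : ℝ) * lamCoeffOf A N μ 0 κ' w) * (∑' u', Nr μ 0 u') :=
  blockAvg_M2_eq_of_decay N (Λ := fun μ y u => lamCoeffOf A N μ y κ' u) (Nr := Nr) α β (lamCoeff_cov hAcov κ') hcovN hδ hδ'
    (lamCoeff_decay hA hC hδ κ') hNr (lamCoeff_null₀ hA hC hδ κ') (lamCoeff_null₁ hA hC hδ κ')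

/-- [folklore] **THE SHAPE OF THE END ROW `hLam`**: if the zero-momentum responses vanish (`Σ'_{u′} Nr μ 0 u′ = 0` for every `μ` — the linear-gauge
letter of FINDING F-g9-1 summed over the partners `X`, DISPLAYED here as a hypothesis), the block-averaged second moment of the `Λ′⊗X` word is ZERO. -/
theorem blockAvg_M2_lamCoeffOf_eq_zero_of_zeroMomentum [NeZero N] (hA : Decays A C δ) (hC : 0 ≤ C) (hδ : 0 < δ)
    (hAcov : ∀ t : Fin (d + 1) → ℤ, shiftK (-((N : ℤ) • t)) A = A) (κ' α β : Fin (d + 1))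
    (Nr : Fin (d + 1) → Site (d + 1) → Site (d + 1) → ℝ) {C' δ' : ℝ} (hδ' : 0 < δ')
    (hcovN : ∀ μ y t u', Nr μ (y + t) (u' + (N : ℤ) • t) = Nr μ y u')
    (hNr : ∀ μ y u, |Nr μ y u| ≤ C' * Real.exp (-δ' * l1 ((N : ℤ) • y - u)))
    (hZero : ∀ μ : Fin (d + 1), ∑' u' : Site (d + 1), Nr μ 0 u' = 0) :
    ((N : ℝ) ^ (d + 1))⁻¹ * ∑ b ∈ box (d + 1) N, ∑' u', ((((u' - toSite b) α : ℤ) : ℝ) * (((u' - toSite b) β : ℤ) : ℝ))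
        * (∑ μ, ∑' y, lamCoeffOf A N μ y κ' (toSite b) * Nr μ y u') = 0 := by
  rw [blockAvg_M2_lamCoeffOf_eq hA hC hδ hAcov κ' α β Nr hδ' hcovN hNr]
  simp only [hZero, mul_zero, Finset.sum_const_zero]

end Summit.QuantumFields.BalabanUV.Beta.D1BFx.LamCoeffMoments

end
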